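import Summits.CriticalPhenomena.PercolationContinuityZ3.Theorems.Transplant.FKConnectivityAllQForestAdjacentFanTwoTools
import Literature.Barriers.CriticalPhenomena.KozmaNachmiasAdmissible
import HarnessLib

/-!
# The square-free adjacent forest Rayleigh inequality HOLDS when `v` and `y` have a common neighbour `x` adjacent to `o`
# (the fan of length two — part 2: the last three toggle pieces and the assembly)

Support file (`--supports stmt-CriticalPhenomena-4575`), FK sub-lane `prim-bschramm-fk-1` (gen 21) of the post-continuity programme;
builds on p205010 (kernel theorem, internal audit signed; external expert review pending).  No definitions, no named facts, no sorries;
standard axioms.  Part 2 of 2 (part 1: `…ForestAdjacentFanTwoTools`).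

THE NODE (`AdjForestRayleighNoSqOn`): `#(Fo ∩ {e, f ∈ ω}, Fo) ≤ #(Fo ∩ {e ∈ ω}, Fo ∩ {f ∈ ω})` on every fibre — two pairs `e = ov`,
`f = oy` at a common vertex are negatively correlated in the uniform ordered two-forest partition of a finite multigraph.  Known in the
tree: `deg o ≤ 3`, `Fin 4`, separator equalities, 2-sums, triangles `{e, f, vy}` (gen 21).  THIS FILE: **`adjForestNoSq_fibre_of_fanTwo`**
— the node's inequality on every fibre `(M, u₀)` containing the pairs `ox, vx, xy` (in `M ∪ u₀`) for some `x ∉ {o, v, y}`, i.e. whenever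
`v` and `y` have a common neighbour that is also a neighbour of `o` (e.g. two spokes at distance two of any wheel, every such pair of an
apex vertex); the ℓ = 2 case of the lineage's LOCALLY-CONNECTED THEOREM (memo bschramm/FROM-fk-1-g21-SIGMA-EXCHANGE.md §3, proved on
paper for all ℓ by the near-tight gadget lemma and two toggling involutions; exact identity `Good₁ − Bad = 2·N_out` verified).
* pieces **`fanTwo_piece_h_neg`** (`ι'` then swap; partner does not join `o, v` off `{p, q}` — Literature's `reachable_insert_cases` on the pair `q`),
  **`fanTwo_piece_none_pos`** (`ι`; `x ~ v` off `{e, f}`), **`fanTwo_piece_none_neg`** (`ι'` then swap);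
* **`adjForestNoSq_fibre_of_fanTwo_mem`** (all five fan pairs free, `o, v, x, y` distinct): five predicate splits of the bad count, eight
  of the good count, the six piece inequalities, `omega`;
* **`adjForestNoSq_fibre_of_fanTwo_hDoubled`** (`ox ∈ u₀`: the single toggle `f ↔ q`), **`adjForestNoSq_fibre_of_fanTwo`** (general
  fibres: loops / absent / doubled pinned pairs as in `adjForestNoSq_fibre_of_triangle`; doubled `vx` or `xy` is
  `adjForestNoSq_fibre_of_triangle_cluster`).
[cite: SempleWelsh2008, Conj. 1.1 (p. 2); Thm. 4.2 (p. 11)] [cite: Linusson2011, Prop. 2.6] [cite: Grimmett2006, §1.5 (p. 13)]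
-/

noncomputable section

namespace Summit.CriticalPhenomena.PercolationContinuityZ3.Theorems
namespace FK

open MeasureTheory Set Literature.Probability.LatticeModels Literature.Probability.Percolation
open scoped Classical symmDiff

variable {V : Type*} [Fintype V]

section FanTwo

variable {M u₀ : BondConfig V} {o v x y : V}

/-! #### The last three pieces -/

section Pieces

variable (hov : o ≠ v) (hox : o ≠ x) (hoy : o ≠ y) (hvx : v ≠ x) (hvy : v ≠ y) (hxy : x ≠ y)
  (heM : s(o, v) ∈ M) (hhM : s(o, x) ∈ M) (hfM : s(o, y) ∈ M) (hpM : s(v, x) ∈ M) (hqM : s(x, y) ∈ M)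
include hov hox hoy hvx hvy hxy heM hhM hfM hpM hqM

omit hfM hoy in
/-- **Piece `h ∈ ω`, partner does not join `o, v` off `{p, q}`**: toggle `e ↔ p`, then swap; lands in `{q ∈ ω', h, p ∉ ω'}` with
`x ≁ v` off `{e, q}`. [cite: Linusson2011, Prop. 2.6] [cite: Grimmett2006, §1.5 (p. 13)] -/
theorem fanTwo_piece_h_neg :
    fibreCount M u₀ (forestEv V ∩ {ω | s(o, v) ∈ ω ∧ s(o, y) ∈ ω} ∩ {ω | s(v, x) ∈ ω}ᶜ ∩ {ω | s(x, y) ∈ ω}ᶜ ∩ {ω | s(o, x) ∈ ω} ∩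
        {ω | (openGraph (((ω ∆ M) \ {s(x, y)}) \ {s(v, x)})).Reachable o v}ᶜ) (forestEv V) ≤
      fibreCount M u₀ (forestEv V ∩ {ω | s(o, v) ∈ ω} ∩ {ω | s(x, y) ∈ ω} ∩ {ω | s(o, x) ∈ ω}ᶜ ∩ {ω | s(v, x) ∈ ω}ᶜ ∩
        {ω | (openGraph ((ω \ {s(o, v)}) \ {s(x, y)})).Reachable x v}ᶜ) (forestEv V ∩ {ω | s(o, y) ∈ ω}) := by
  refine le_trans (fibreCount_exchange_le_of heM hpM fun ω hω hA hB => ?_) (le_of_eq (fibreCount_swap _ _ _ _))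
  obtain ⟨⟨⟨⟨⟨hF, he, hf⟩, hp⟩, hq⟩, hh⟩, hR⟩ := hA
  have hp : s(v, x) ∉ ω := hp
  have hq : s(x, y) ∉ ω := hq
  have hR : ¬ (openGraph (((ω ∆ M) \ {s(x, y)}) \ {s(v, x)})).Reachable o v := hR
  have hB' : IsForestCfg (ω ∆ M) := hB
  have hpB : s(v, x) ∈ ω ∆ M := (mem_symmDiff_iff_not_mem hpM).2 hp
  have hqB : s(x, y) ∈ ω ∆ M := (mem_symmDiff_iff_not_mem hqM).2 hq
  have hhB : s(o, x) ∉ ω ∆ M := fun h => ((mem_symmDiff_iff_not_mem hhM).1 h) hh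
  have heB : s(o, v) ∉ (ω ∆ M) \ {s(v, x)} := fun h => ((mem_symmDiff_iff_not_mem heM).1 h.1) he
  have hsepA : ¬ (openGraph (ω \ {s(o, v)})).Reachable v x := by
    intro hr
    have hxo : (openGraph (ω \ {s(o, v)})).Reachable x o :=
      reach_of_mem_sdiff (by rw [Sym2.eq_swap]; exact hh) hox.symm (by rw [Sym2.eq_swap]; exact (fanTwo_e_ne_h hvx).symm)
    exact not_reachable_sdiff_singleton_of_mem hF hov he (hr.trans hxo).symm
  have hsepB : ¬ (openGraph ((ω ∆ M) \ {s(v, x)})).Reachable o v := by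
    intro hr
    set X : BondConfig V := ((ω ∆ M) \ {s(x, y)}) \ {s(v, x)} with hX
    have hsub : (ω ∆ M) \ {s(v, x)} ⊆ insert s(x, y) X := by
      intro z hz
      by_cases hzq : z = s(x, y)
      · exact hzq ▸ mem_insert _ _
      · exact mem_insert_of_mem _ ⟨⟨hz.1, hzq⟩, hz.2⟩
    have hXsub : X ⊆ (ω ∆ M) \ {s(v, x)} := fun z hz => ⟨hz.1.1, hz.2⟩
    have hqX : (openGraph ((ω ∆ M) \ {s(v, x)})).Reachable x y := reach_of_mem_sdiff hqB hxy (fanTwo_p_ne_q hvx hvy).symm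
    rcases Literature.Barriers.CriticalPhenomena.reachable_insert_cases (hr.mono (openGraph_mono hsub)) with h0 | ⟨h1, h2⟩ | ⟨h1, h2⟩
    · exact hR h0
    · exact not_reachable_sdiff_singleton_of_mem hB' hvx hpB ((h2.mono (openGraph_mono hXsub)).symm.trans hqX.symm)
    · exact not_reachable_sdiff_singleton_of_mem hB' hvx hpB (h2.mono (openGraph_mono hXsub)).symm
  refine ⟨he, hp, ⟨?_, mem_insert_of_mem _ ⟨hf, (fanTwo_e_ne_f hvy).symm⟩⟩, ⟨⟨⟨⟨?_, mem_insert _ _⟩, ?_⟩, ?_⟩, ?_⟩, ?_⟩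
  · exact (isForestCfg_insert_iff hvx fun h => hp h.1).2 ⟨isForestCfg_of_subset hF sdiff_subset, hsepA⟩
  · exact (isForestCfg_insert_iff hov heB).2 ⟨isForestCfg_of_subset hB' sdiff_subset, hsepB⟩
  · exact mem_insert_of_mem _ ⟨hqB, (fanTwo_p_ne_q hvx hvy).symm⟩
  · rintro (h | h)
    · exact fanTwo_e_ne_h hvx h.symm
    · exact hhB h.1
  · rintro (h | h)
    · exact fanTwo_e_ne_p hov hox h.symm
    · exact h.2 rfl
  · intro hr
    have hsub : (insert s(o, v) ((ω ∆ M) \ {s(v, x)}) \ {s(o, v)}) \ {s(x, y)} ⊆ (ω ∆ M) \ {s(v, x)} := by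
      rintro z ⟨⟨hz | hz, hze⟩, -⟩
      · exact absurd hz hze
      · exact hz
    exact not_reachable_sdiff_singleton_of_mem hB' hvx hpB (hr.mono (openGraph_mono hsub)).symm

omit heM hpM in
/-- **Piece `h, p, q ∉ ω`, `x ~ v` off `{e, f}`** (inside 2-forest `{e, f}`): toggle `f ↔ q`; lands in `{q ∈ ω', h, p ∉ ω'}` with the bit
set. [cite: Linusson2011, Prop. 2.6] [cite: Grimmett2006, §1.5 (p. 13)] -/
theorem fanTwo_piece_none_pos :
    fibreCount M u₀ (forestEv V ∩ {ω | s(o, v) ∈ ω ∧ s(o, y) ∈ ω} ∩ {ω | s(v, x) ∈ ω}ᶜ ∩ {ω | s(x, y) ∈ ω}ᶜ ∩ {ω | s(o, x) ∈ ω}ᶜ ∩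
        {ω | (openGraph ((ω \ {s(o, y)}) \ {s(o, v)})).Reachable x v}) (forestEv V) ≤
      fibreCount M u₀ (forestEv V ∩ {ω | s(o, v) ∈ ω} ∩ {ω | s(x, y) ∈ ω} ∩ {ω | s(o, x) ∈ ω}ᶜ ∩ {ω | s(v, x) ∈ ω}ᶜ ∩
        {ω | (openGraph ((ω \ {s(o, v)}) \ {s(x, y)})).Reachable x v}) (forestEv V ∩ {ω | s(o, y) ∈ ω}) := by
  refine fibreCount_exchange_le_of hfM hqM fun ω hω hA hB => ?_
  obtain ⟨⟨⟨⟨⟨hF, he, hf⟩, hp⟩, hq⟩, hh⟩, hR⟩ := hA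
  have hp : s(v, x) ∉ ω := hp
  have hq : s(x, y) ∉ ω := hq
  have hh : s(o, x) ∉ ω := hh
  have hB' : IsForestCfg (ω ∆ M) := hB
  have hqB : s(x, y) ∈ ω ∆ M := (mem_symmDiff_iff_not_mem hqM).2 hq
  have hhB : s(o, x) ∈ ω ∆ M := (mem_symmDiff_iff_not_mem hhM).2 hh
  have hfB : s(o, y) ∉ (ω ∆ M) \ {s(x, y)} := fun h => ((mem_symmDiff_iff_not_mem hfM).1 h.1) hf
  have hsepA : ¬ (openGraph (ω \ {s(o, y)})).Reachable x y := by
    intro hr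
    have hxv : (openGraph (ω \ {s(o, y)})).Reachable x v := hR.mono (openGraph_mono sdiff_subset)
    have hov' : (openGraph (ω \ {s(o, y)})).Reachable o v := reach_of_mem_sdiff he hov (fanTwo_e_ne_f hvy)
    exact not_reachable_sdiff_singleton_of_mem hF hoy hf ((hov'.trans hxv.symm).trans hr)
  have hsepB : ¬ (openGraph ((ω ∆ M) \ {s(x, y)})).Reachable o y := by
    intro hr
    have hxo : (openGraph ((ω ∆ M) \ {s(x, y)})).Reachable x o :=
      reach_of_mem_sdiff (by rw [Sym2.eq_swap]; exact hhB) hox.symm (by rw [Sym2.eq_swap]; exact fanTwo_h_ne_q hox hoy)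
    exact not_reachable_sdiff_singleton_of_mem hB' hxy hqB (hxo.trans hr)
  refine ⟨hf, hq, ⟨⟨⟨⟨⟨?_, mem_insert_of_mem _ ⟨he, fanTwo_e_ne_f hvy⟩⟩, mem_insert _ _⟩, ?_⟩, ?_⟩, ?_⟩, ?_, mem_insert _ _⟩
  · exact (isForestCfg_insert_iff hxy fun h => hq h.1).2 ⟨isForestCfg_of_subset hF sdiff_subset, hsepA⟩
  · rintro (h | h)
    · exact fanTwo_h_ne_q hox hoy h
    · exact hh h.1
  · rintro (h | h)
    · exact fanTwo_p_ne_q hvx hvy h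
    · exact hp h.1
  · refine hR.mono (openGraph_mono fun z hz => ⟨⟨mem_insert_of_mem _ ⟨hz.1.1, hz.1.2⟩, hz.2⟩, fun hzq => hq ?_⟩)
    rw [mem_singleton_iff] at hzq
    exact hzq ▸ hz.1.1
  · exact (isForestCfg_insert_iff hoy hfB).2 ⟨isForestCfg_of_subset hB' sdiff_subset, hsepB⟩

omit hfM hxy in
/-- **Piece `h, p, q ∉ ω`, `x ≁ v` off `{e, f}`**: toggle `e ↔ p`, then swap; lands in `{q, h ∈ ω', p ∉ ω'}` with the partner bit
unset. [cite: Linusson2011, Prop. 2.6] [cite: Grimmett2006, §1.5 (p. 13)] -/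
theorem fanTwo_piece_none_neg :
    fibreCount M u₀ (forestEv V ∩ {ω | s(o, v) ∈ ω ∧ s(o, y) ∈ ω} ∩ {ω | s(v, x) ∈ ω}ᶜ ∩ {ω | s(x, y) ∈ ω}ᶜ ∩ {ω | s(o, x) ∈ ω}ᶜ ∩
        {ω | (openGraph ((ω \ {s(o, y)}) \ {s(o, v)})).Reachable x v}ᶜ) (forestEv V) ≤
      fibreCount M u₀ (forestEv V ∩ {ω | s(o, v) ∈ ω} ∩ {ω | s(x, y) ∈ ω} ∩ {ω | s(o, x) ∈ ω} ∩ {ω | s(v, x) ∈ ω}ᶜ ∩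
        {ω | (openGraph (((ω ∆ M) \ {s(x, y)}) \ {s(v, x)})).Reachable o v}ᶜ) (forestEv V ∩ {ω | s(o, y) ∈ ω}) := by
  refine le_trans (fibreCount_exchange_le_of heM hpM fun ω hω hA hB => ?_) (le_of_eq (fibreCount_swap _ _ _ _))
  obtain ⟨⟨⟨⟨⟨hF, he, hf⟩, hp⟩, hq⟩, hh⟩, hR⟩ := hA
  have hp : s(v, x) ∉ ω := hp
  have hq : s(x, y) ∉ ω := hq
  have hh : s(o, x) ∉ ω := hh
  have hR : ¬ (openGraph ((ω \ {s(o, y)}) \ {s(o, v)})).Reachable x v := hR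
  have hB' : IsForestCfg (ω ∆ M) := hB
  have hpB : s(v, x) ∈ ω ∆ M := (mem_symmDiff_iff_not_mem hpM).2 hp
  have hqB : s(x, y) ∈ ω ∆ M := (mem_symmDiff_iff_not_mem hqM).2 hq
  have hhB : s(o, x) ∈ ω ∆ M := (mem_symmDiff_iff_not_mem hhM).2 hh
  have heB : s(o, v) ∉ (ω ∆ M) \ {s(v, x)} := fun h => ((mem_symmDiff_iff_not_mem heM).1 h.1) he
  have hsepA : ¬ (openGraph (ω \ {s(o, v)})).Reachable v x := by
    intro hr
    set X : BondConfig V := (ω \ {s(o, y)}) \ {s(o, v)} with hX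
    have hsub : ω \ {s(o, v)} ⊆ insert s(o, y) X := by
      intro z hz
      by_cases hzf : z = s(o, y)
      · exact hzf ▸ mem_insert _ _
      · exact mem_insert_of_mem _ ⟨⟨hz.1, hzf⟩, hz.2⟩
    have hXsub : X ⊆ ω \ {s(o, v)} := fun z hz => ⟨hz.1.1, hz.2⟩
    have hne := not_reachable_sdiff_singleton_of_mem hF hov he
    have hfy : (openGraph (ω \ {s(o, v)})).Reachable y o :=
      reach_of_mem_sdiff (by rw [Sym2.eq_swap]; exact hf) hoy.symm (by rw [Sym2.eq_swap]; exact (fanTwo_e_ne_f hvy).symm)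
    rcases Literature.Barriers.CriticalPhenomena.reachable_insert_cases (hr.mono (openGraph_mono hsub)) with h0 | ⟨h1, h2⟩ | ⟨h1, h2⟩
    · exact hR h0.symm
    · exact hne (h1.mono (openGraph_mono hXsub)).symm
    · exact hne ((h1.mono (openGraph_mono hXsub)).trans hfy).symm
  have hsepB : ¬ (openGraph ((ω ∆ M) \ {s(v, x)})).Reachable o v := by
    intro hr
    have hxo : (openGraph ((ω ∆ M) \ {s(v, x)})).Reachable x o :=
      reach_of_mem_sdiff (by rw [Sym2.eq_swap]; exact hhB) hox.symm (by rw [Sym2.eq_swap]; exact fanTwo_h_ne_p hov)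
    exact not_reachable_sdiff_singleton_of_mem hB' hvx hpB (hxo.trans hr).symm
  have hpart : insert s(v, x) (ω \ {s(o, v)}) ∆ M = insert s(o, v) ((ω ∆ M) \ {s(v, x)}) :=
    insert_sdiff_singleton_symmDiff heM hpM he hp
  have hpart' : insert s(o, v) ((ω ∆ M) \ {s(v, x)}) ∆ M = insert s(v, x) (ω \ {s(o, v)}) := by
    rw [← hpart, symmDiff_symmDiff_cancel_right]
  refine ⟨he, hp, ⟨?_, mem_insert_of_mem _ ⟨hf, (fanTwo_e_ne_f hvy).symm⟩⟩, ⟨⟨⟨⟨?_, mem_insert _ _⟩, ?_⟩, ?_⟩, ?_⟩, ?_⟩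
  · exact (isForestCfg_insert_iff hvx fun h => hp h.1).2 ⟨isForestCfg_of_subset hF sdiff_subset, hsepA⟩
  · exact (isForestCfg_insert_iff hov heB).2 ⟨isForestCfg_of_subset hB' sdiff_subset, hsepB⟩
  · exact mem_insert_of_mem _ ⟨hqB, (fanTwo_p_ne_q hvx hvy).symm⟩
  · exact mem_insert_of_mem _ ⟨hhB, fanTwo_h_ne_p hov⟩
  · rintro (h | h)
    · exact fanTwo_e_ne_p hov hox h.symm
    · exact h.2 rfl
  · show ¬ (openGraph (((insert s(o, v) ((ω ∆ M) \ {s(v, x)}) ∆ M) \ {s(x, y)}) \ {s(v, x)})).Reachable o v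
    rw [hpart']
    intro hr
    have hsub : (insert s(v, x) (ω \ {s(o, v)}) \ {s(x, y)}) \ {s(v, x)} ⊆ ω \ {s(o, v)} := by
      rintro z ⟨⟨hz | hz, -⟩, hzp⟩
      · exact absurd hz hzp
      · exact hz
    exact not_reachable_sdiff_singleton_of_mem hF hov he (hr.mono (openGraph_mono hsub))

end Pieces

/-! #### Assembly -/

/-- **THE FAN-OF-LENGTH-TWO THEOREM, main case** (`e = ov`, `h = ox`, `f = oy`, `p = vx`, `q = xy` all in `M`; `o, v, x, y` distinct):
`#(Fo ∩ {e, f ∈ ω}, Fo) ≤ #(Fo ∩ {e ∈ ω}, Fo ∩ {f ∈ ω})` on the fibre `(M, u₀)`.  [cite: SempleWelsh2008, Conj. 1.1 (p. 2)]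
[cite: Linusson2011, Prop. 2.6] [cite: Grimmett2006, §1.5 (p. 13)] -/
theorem adjForestNoSq_fibre_of_fanTwo_mem (hov : o ≠ v) (hox : o ≠ x) (hoy : o ≠ y) (hvx : v ≠ x) (hvy : v ≠ y) (hxy : x ≠ y)
    (heM : s(o, v) ∈ M) (hhM : s(o, x) ∈ M) (hfM : s(o, y) ∈ M) (hpM : s(v, x) ∈ M) (hqM : s(x, y) ∈ M) :
    fibreCount M u₀ (forestEv V ∩ {ω | s(o, v) ∈ ω ∧ s(o, y) ∈ ω}) (forestEv V) ≤
      fibreCount M u₀ (forestEv V ∩ {ω | s(o, v) ∈ ω}) (forestEv V ∩ {ω | s(o, y) ∈ ω}) := by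
  -- the six sources
  have s1 := fibreCount_split_pred M u₀ (forestEv V ∩ {ω | s(o, v) ∈ ω ∧ s(o, y) ∈ ω}) (forestEv V) {ω | s(v, x) ∈ ω}
  have s2 := fibreCount_split_pred M u₀ (forestEv V ∩ {ω | s(o, v) ∈ ω ∧ s(o, y) ∈ ω} ∩ {ω | s(v, x) ∈ ω}ᶜ) (forestEv V)
    {ω | s(x, y) ∈ ω}
  have s3 := fibreCount_split_pred M u₀ (forestEv V ∩ {ω | s(o, v) ∈ ω ∧ s(o, y) ∈ ω} ∩ {ω | s(v, x) ∈ ω}ᶜ ∩ {ω | s(x, y) ∈ ω}ᶜ)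
    (forestEv V) {ω | s(o, x) ∈ ω}
  have s4 := fibreCount_split_pred M u₀
    (forestEv V ∩ {ω | s(o, v) ∈ ω ∧ s(o, y) ∈ ω} ∩ {ω | s(v, x) ∈ ω}ᶜ ∩ {ω | s(x, y) ∈ ω}ᶜ ∩ {ω | s(o, x) ∈ ω}) (forestEv V)
    {ω | (openGraph (((ω ∆ M) \ {s(x, y)}) \ {s(v, x)})).Reachable o v}
  have s5 := fibreCount_split_pred M u₀
    (forestEv V ∩ {ω | s(o, v) ∈ ω ∧ s(o, y) ∈ ω} ∩ {ω | s(v, x) ∈ ω}ᶜ ∩ {ω | s(x, y) ∈ ω}ᶜ ∩ {ω | s(o, x) ∈ ω}ᶜ) (forestEv V)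
    {ω | (openGraph ((ω \ {s(o, y)}) \ {s(o, v)})).Reachable x v}
  -- the six targets inside the good count
  have t1 := fibreCount_split_pred M u₀ (forestEv V ∩ {ω | s(o, v) ∈ ω}) (forestEv V ∩ {ω | s(o, y) ∈ ω}) {ω | s(x, y) ∈ ω}
  have t2 := fibreCount_split_pred M u₀ (forestEv V ∩ {ω | s(o, v) ∈ ω} ∩ {ω | s(x, y) ∈ ω}) (forestEv V ∩ {ω | s(o, y) ∈ ω})
    {ω | s(o, x) ∈ ω}
  have t3 := fibreCount_split_pred M u₀ (forestEv V ∩ {ω | s(o, v) ∈ ω} ∩ {ω | s(x, y) ∈ ω} ∩ {ω | s(o, x) ∈ ω})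
    (forestEv V ∩ {ω | s(o, y) ∈ ω}) {ω | s(v, x) ∈ ω}
  have t4 := fibreCount_split_pred M u₀ (forestEv V ∩ {ω | s(o, v) ∈ ω} ∩ {ω | s(x, y) ∈ ω} ∩ {ω | s(o, x) ∈ ω} ∩ {ω | s(v, x) ∈ ω}ᶜ)
    (forestEv V ∩ {ω | s(o, y) ∈ ω}) {ω | (openGraph (((ω ∆ M) \ {s(x, y)}) \ {s(v, x)})).Reachable o v}
  have t5 := fibreCount_split_pred M u₀ (forestEv V ∩ {ω | s(o, v) ∈ ω} ∩ {ω | s(x, y) ∈ ω} ∩ {ω | s(o, x) ∈ ω}ᶜ)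
    (forestEv V ∩ {ω | s(o, y) ∈ ω}) {ω | s(v, x) ∈ ω}
  have t6 := fibreCount_split_pred M u₀ (forestEv V ∩ {ω | s(o, v) ∈ ω} ∩ {ω | s(x, y) ∈ ω} ∩ {ω | s(o, x) ∈ ω}ᶜ ∩ {ω | s(v, x) ∈ ω}ᶜ)
    (forestEv V ∩ {ω | s(o, y) ∈ ω}) {ω | (openGraph ((ω \ {s(o, v)}) \ {s(x, y)})).Reachable x v}
  have t7 := fibreCount_split_pred M u₀ (forestEv V ∩ {ω | s(o, v) ∈ ω} ∩ {ω | s(x, y) ∈ ω}ᶜ) (forestEv V ∩ {ω | s(o, y) ∈ ω})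
    {ω | s(o, x) ∈ ω}
  have t8 := fibreCount_split_pred M u₀ (forestEv V ∩ {ω | s(o, v) ∈ ω} ∩ {ω | s(x, y) ∈ ω}ᶜ ∩ {ω | s(o, x) ∈ ω})
    (forestEv V ∩ {ω | s(o, y) ∈ ω}) {ω | s(v, x) ∈ ω}
  have h1 := fanTwo_piece_p (u₀ := u₀) hov hox hoy hvx hvy hxy hhM hfM hqM
  have h2 := fanTwo_piece_q (u₀ := u₀) hov hox hoy hvx hvy hxy heM hhM hpM hqM
  have h3 := fanTwo_piece_h_pos (u₀ := u₀) hox hoy hvx hvy hxy hfM hpM hqM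
  have h4 := fanTwo_piece_h_neg (u₀ := u₀) hov hox hvx hvy hxy heM hhM hpM hqM
  have h5 := fanTwo_piece_none_pos (u₀ := u₀) hov hox hoy hvx hvy hxy hhM hfM hqM
  have h6 := fanTwo_piece_none_neg (u₀ := u₀) hov hox hoy hvx hvy heM hhM hpM hqM
  omega

/-- **Doubled `h`** (`o ~ x` already in the common part): the toggle `f ↔ q` alone maps bad pairs injectively to good ones
(`f` and `q` are parallel in the contracted multigraph). [cite: Linusson2011, Prop. 2.6] [cite: Grimmett2006, §1.5 (p. 13)] -/
theorem adjForestNoSq_fibre_of_fanTwo_hDoubled (hd : Disjoint u₀ M) (hox : o ≠ x) (hoy : o ≠ y) (hvy : v ≠ y) (hxy : x ≠ y)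
    (hfM : s(o, y) ∈ M) (hqM : s(x, y) ∈ M) (hox' : (openGraph u₀).Reachable o x) :
    fibreCount M u₀ (forestEv V ∩ {ω | s(o, v) ∈ ω ∧ s(o, y) ∈ ω}) (forestEv V) ≤
      fibreCount M u₀ (forestEv V ∩ {ω | s(o, v) ∈ ω}) (forestEv V ∩ {ω | s(o, y) ∈ ω}) := by
  have hdis : ∀ {g : Sym2 V}, g ∈ M → g ∉ u₀ := fun hg hgu => Set.disjoint_left.1 hd hgu hg
  refine le_trans (fibreCount_exchange_le_of hfM hqM (A' := forestEv V ∩ {ω | s(o, v) ∈ ω} ∩ {ω | s(x, y) ∈ ω})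
    (B' := forestEv V ∩ {ω | s(o, y) ∈ ω}) fun ω hω hA hB => ?_) (fibreCount_mono_fibre M u₀ fun ω _ hA hB => ⟨hA.1, hB⟩)
  obtain ⟨hF, he, hf⟩ := hA
  have hB' : IsForestCfg (ω ∆ M) := hB
  have hu : u₀ ⊆ ω := subset_of_fibre hω
  have huB : u₀ ⊆ ω ∆ M := subset_symmDiff_of_fibre hω
  have huf : u₀ ⊆ ω \ {s(o, y)} := fun z hz => ⟨hu hz, fun h => hdis hfM (mem_singleton_iff.1 h ▸ hz)⟩
  have hsepA : ¬ (openGraph (ω \ {s(o, y)})).Reachable x y := fun hr =>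
    not_reachable_sdiff_singleton_of_mem hF hoy hf ((hox'.mono (openGraph_mono huf)).trans hr)
  have hq : s(x, y) ∉ ω := fun hq' => hsepA (reach_of_mem_sdiff hq' hxy (fanTwo_f_ne_q hox).symm)
  have hqB : s(x, y) ∈ ω ∆ M := (mem_symmDiff_iff_not_mem hqM).2 hq
  have huq : u₀ ⊆ (ω ∆ M) \ {s(x, y)} := fun z hz => ⟨huB hz, fun h => hdis hqM (mem_singleton_iff.1 h ▸ hz)⟩
  have hfB : s(o, y) ∉ (ω ∆ M) \ {s(x, y)} := fun h => ((mem_symmDiff_iff_not_mem hfM).1 h.1) hf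
  have hsepB : ¬ (openGraph ((ω ∆ M) \ {s(x, y)})).Reachable o y := fun hr =>
    not_reachable_sdiff_singleton_of_mem hB' hxy hqB ((hox'.mono (openGraph_mono huq)).symm.trans hr)
  refine ⟨hf, hq, ⟨⟨?_, mem_insert_of_mem _ ⟨he, fanTwo_e_ne_f hvy⟩⟩, mem_insert _ _⟩, ?_, mem_insert _ _⟩
  · exact (isForestCfg_insert_iff hxy fun h => hq h.1).2 ⟨isForestCfg_of_subset hF sdiff_subset, hsepA⟩
  · exact (isForestCfg_insert_iff hoy hfB).2 ⟨isForestCfg_of_subset hB' sdiff_subset, hsepB⟩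

/-- **THE FAN-OF-LENGTH-TWO THEOREM** (the node's inequality on every fibre containing the fan `o ∗ (v x y)`): for `o, v, x, y` with
`x ∉ {o, v, y}`, `v ≠ y`, and `ox, vx, xy ∈ M ∪ u₀`: `#(Fo ∩ {ov, oy ∈ ω}, Fo) ≤ #(Fo ∩ {ov ∈ ω}, Fo ∩ {oy ∈ ω})` on `(M, u₀)`.
In words: in the uniform ordered two-forest partition of a finite multigraph, the pairs `ov, oy` are negatively correlated as soon as
`v` and `y` have a common neighbour `x` adjacent to `o`.  (Loops / absent / doubled pinned pairs as in
`adjForestNoSq_fibre_of_triangle`; doubled `vx` or `xy` is the triangle theorem through the `u₀`-clusters; doubled `ox` is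
`adjForestNoSq_fibre_of_fanTwo_hDoubled`.) [cite: SempleWelsh2008, Conj. 1.1 (p. 2); Thm. 4.2 (p. 11)] [cite: Linusson2011, Prop. 2.6]
[cite: Grimmett2006, §1.5 (p. 13)] -/
theorem adjForestNoSq_fibre_of_fanTwo (hd : Disjoint u₀ M) (hox : o ≠ x) (hvx : v ≠ x) (hvy : v ≠ y) (hxy : x ≠ y)
    (hh : s(o, x) ∈ M ∨ s(o, x) ∈ u₀) (hp : s(v, x) ∈ M ∨ s(v, x) ∈ u₀) (hq : s(x, y) ∈ M ∨ s(x, y) ∈ u₀) :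
    fibreCount M u₀ (forestEv V ∩ {ω | s(o, v) ∈ ω ∧ s(o, y) ∈ ω}) (forestEv V) ≤
      fibreCount M u₀ (forestEv V ∩ {ω | s(o, v) ∈ ω}) (forestEv V ∩ {ω | s(o, y) ∈ ω}) := by
  -- loops: the left side vanishes
  by_cases hov : o = v
  · subst hov
    rw [fibreCount_eq_zero_of_forall _ _ _ _ fun ω _ hA _ =>
      not_mem_of_isForestCfg_of_isDiag hA.1 (Sym2.mk_isDiag_iff.2 rfl) hA.2.1]
    exact Nat.zero_le _
  by_cases hoy : o = y
  · subst hoy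
    rw [fibreCount_eq_zero_of_forall _ _ _ _ fun ω _ hA _ =>
      not_mem_of_isForestCfg_of_isDiag hA.1 (Sym2.mk_isDiag_iff.2 rfl) hA.2.2]
    exact Nat.zero_le _
  -- a pinned pair outside the fibre: the left side vanishes
  by_cases he : s(o, v) ∉ M ∧ s(o, v) ∉ u₀
  · rw [fibreCount_eq_zero_of_forall _ _ _ _ fun ω hω hA _ =>
      (mem_union_of_fibre hω hA.2.1).elim he.1 he.2]
    exact Nat.zero_le _
  by_cases hf : s(o, y) ∉ M ∧ s(o, y) ∉ u₀
  · rw [fibreCount_eq_zero_of_forall _ _ _ _ fun ω hω hA _ =>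
      (mem_union_of_fibre hω hA.2.2).elim hf.1 hf.2]
    exact Nat.zero_le _
  rw [not_and_or, not_not, not_not] at he hf
  have hdis : ∀ {g : Sym2 V}, g ∈ u₀ → g ∉ M := fun hg' hgM => Set.disjoint_left.1 hd hg' hgM
  rcases he with heM | heu
  · rcases hf with hfM | hfu
    · -- the pinned pairs are free; now the three fan pairs
      rcases hh with hhM | hhu
      · rcases hp with hpM | hpu
        · rcases hq with hqM | hqu
          · exact adjForestNoSq_fibre_of_fanTwo_mem hov hox hoy hvx hvy hxy heM hhM hfM hpM hqM
          · -- `xy` doubled: `vx` joins `v` to the `u₀`-cluster of `y`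
            exact adjForestNoSq_fibre_of_triangle_cluster hd hvy SimpleGraph.Reachable.rfl
              (reach_of_mem hqu hxy).symm (Or.inl hpM)
        · -- `vx` doubled: `xy` joins the `u₀`-cluster of `v` to `y`
          exact adjForestNoSq_fibre_of_triangle_cluster hd hvy (reach_of_mem hpu hvx) SimpleGraph.Reachable.rfl hq
      · -- `ox` doubled
        rcases hq with hqM | hqu
        · exact adjForestNoSq_fibre_of_fanTwo_hDoubled hd hox hoy hvy hxy hfM hqM (reach_of_mem hhu hox)
        · -- `ox, xy` doubled: `o ~ y` in `u₀`, so `f` closes a cycle in every counted `ω`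
          rw [fibreCount_eq_zero_of_forall _ _ _ _ fun ω hω hA _ =>
            not_isForestCfg_of_mem_of_reachable hA.2.2 (hdis.mt fun h => h hfM |>.elim) (subset_of_fibre hω)
              ((reach_of_mem hhu hox).trans (reach_of_mem hqu hxy)) hA.1]
          exact Nat.zero_le _
    · refine fibreCount_mono_fibre M u₀ fun ω hω hA hB => ?_
      have hfω : s(o, y) ∈ ω := subset_of_fibre hω hfu
      exact ⟨⟨hA.1, hA.2.1⟩, hB, Set.mem_symmDiff.2 (Or.inl ⟨hfω, hdis hfu⟩)⟩
  · have heM : s(o, v) ∉ M := hdis heu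
    refine le_trans (fibreCount_mono_fibre M u₀ (A' := forestEv V ∩ {ω | s(o, y) ∈ ω}) (B' := forestEv V ∩ {ω | s(o, v) ∈ ω})
      fun ω hω hA hB => ?_) (le_of_eq (fibreCount_swap _ _ _ _))
    have heω : s(o, v) ∈ ω := subset_of_fibre hω heu
    exact ⟨⟨hA.1, hA.2.2⟩, hB, Set.mem_symmDiff.2 (Or.inl ⟨heω, heM⟩)⟩

end FanTwo

end FK
end Summit.CriticalPhenomena.PercolationContinuityZ3.Theorems

end
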